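import Literature.Barriers.MatrixMultiplication.IrreversibilityBarrierProofs
import Literature.Barriers.MatrixMultiplication.UniversalMethodBarrierSliceRank
import Literature.Computability.AlgebraicComplexity.RelativeExponentTriangle
import Literature.Computability.AlgebraicComplexity.FlatteningRank
import HarnessLib

/-!
# Lower bounds on `ω(⟨2⟩, t)` by flattening rank and on `ω(t, ⟨2⟩)` by a support functional (CVZ §4.1–4.2)

Topic `Literature/Barriers/MatrixMultiplication`; part of the PROOF of the catalogue entry
`IrreversibilityBarrier` (Christandl–Vrana–Zuiddam, Theory of Computing 17 (2021), art. 2 =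
arXiv:1812.06952, **arXiv numbering**), milestone "Thm. 19 / Thm. 22" (irreversibility of the
Coppersmith–Winograd tensors). CVZ Prop. 17: `i(t) ≥ max_i log₂ rank(t_i) / min_θ log₂ ζ^θ(t)` —
the numerator from the flattening ranks (`R̃(t) ≥ rank(t_i)`), the denominator from Strassen's upper
support functionals (`Q̃(t) ≤ ζ^θ(t)`). This file PROVES the two one-sided bounds in the generality
needed, directly for the tree's infimum formalisation of `ω` (`RelativeExponent.lean`):

* `logb_flatteningRank_le_relativeExponent` — **`log₂ ζ⁽¹⁾(t) ≤ ω(⟨2⟩, t)`** for every tensor over a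
  field: a witness `⟨2⟩^{⊗m} ≥ t^{⊗n}` gives `ζ⁽¹⁾(t)ⁿ = ζ⁽¹⁾(t^{⊗n}) ≤ ζ⁽¹⁾(⟨2⟩^{⊗m}) ≤ R(⟨2⟩^{⊗m}) ≤ 2^m`
  (`flatteningRank_kroneckerPow`, `flatteningRank_mono`, `flatteningRank_le_tensorRank` of
  `FlatteningRank.lean`), and every defining set is nonempty (`⟨2⟩^{⊗m} ≥ ⟨2^m⟩ ≥ ⟨R(t^{⊗n})⟩ ≥ t^{⊗n}`).
* `sliceRank_kroneckerPow_le_of_weights` — **the weighted block bound**: if `w₁, w₂, w₃ ≥ 0` are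
  weights on the three index sets with total mass `≤ 1` each and `w₁(a) w₂(b) w₃(c) ≥ θ³` on the
  support of `t`, then `S(t^{⊗m}) ≤ 3 θ^{-m}` (slice rank; block criterion `sliceRank_le_of_block`:
  `t^{⊗m}` vanishes unless one of the three words has weight `≥ θ^m`, and at most `θ^{-m}` words do,
  by Markov). This is the elementary "probabilistic" form of the support-functional bound
  `Q̃(t) ≤ ζ^{(1/3,1/3,1/3)}(t)` for the uniform `θ`, with Gibbs' inequality replaced by the choice
  of the weights (cross-entropy certificate); for `cw_q` and `CW_q` it is tight (next file).
* `le_mul_logb_of_weights` — hence a witness `t^{⊗m} ≥ ⟨2⟩^{⊗n}` has `n ≤ m · log₂(1/θ)` (tensor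
  with `⟨2⟩^{⊗jn} ≅ ⟨2^{jn}⟩` and Tao's lemma `2^{jn} ≤ S(t^{⊗jm})`, `le_sliceRank_of_restrictsTo_unitTensor`,
  for all `j`, then let `j → ∞`), and `inv_logb_le_relativeExponent_of_weights` —
  **`1 / log₂(1/θ) ≤ ω(t, ⟨2⟩)`** as soon as some power of `t` restricts to `⟨2⟩`.

## References

* M. Christandl, P. Vrana, J. Zuiddam, ToC 17 (2021), art. 2 = arXiv:1812.06952, §2.2, §4.1
  (Prop. 17), §4.2 (proofs of Thm. 19 and Thm. 22). [ChristandlVranaZuiddam2021]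
* V. Strassen, *Degeneration and complexity of bilinear maps: some asymptotic spectra*, J. reine
  angew. Math. 413 (1991), 127–180 — upper support functionals (cited through CVZ §4.2).
* T. Tao, W. Sawin, blog notes on slice rank (2016) — counting bound for slice rank of powers
  (cited through Alman 2021, §2.6, `UniversalMethodBarrier.lean`).
-/

noncomputable section

open scoped BigOperators

namespace Literature.Barriers.MatrixMultiplication

open Literature.Computability.AlgebraicComplexity

universe u

/-! ## `log₂ ζ⁽¹⁾(t) ≤ ω(⟨2⟩, t)` -/

section Flattening

variable {K : Type u} [Field K]
variable {ι κ μ : Type*} [Fintype ι] [Fintype κ] [Fintype μ]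

/-- Every power of a tensor is a restriction of a power of `⟨2⟩`:
`⟨2⟩^{⊗r} ≥ ⟨2^r⟩ ≥ ⟨r⟩ ≥ t^{⊗N}` with `r = R(t^{⊗N})` (so every set defining `ω(⟨2⟩, t)` is nonempty).
[cite: ChristandlVranaZuiddam2021, §2.2] -/
theorem exists_unitTensor_pow_restrictsTo_pow (t : ι → κ → μ → K) (N : ℕ) :
    ∃ m, TensorRestrictsTo (kroneckerPow (unitTensor K 2) m) (kroneckerPow t N) := by
  set r := tensorRank (kroneckerPow t N) with hr
  refine ⟨r, ?_⟩
  have h1 : TensorRestrictsTo (kroneckerPow (unitTensor K 2) r) (unitTensor K (2 ^ r)) :=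
    (tensorMonRestrictsTo_pow_unitTensor 2 r).tensorRestrictsTo
  have h2 : TensorRestrictsTo (unitTensor K (2 ^ r)) (unitTensor K r) :=
    tensorRestrictsTo_unitTensor_castLE (Nat.lt_two_pow_self).le
  exact (h1.trans h2).trans (tensorRestrictsTo_unitTensor_of_tensorRank_le _ le_rfl)

/-- A witness `⟨2⟩^{⊗m} ≥ t^{⊗n}` forces `ζ⁽¹⁾(t)ⁿ ≤ 2^m` (flattening rank is multiplicative,
monotone under restriction and at most the rank). [cite: ChristandlVranaZuiddam2021, §4.1] -/
theorem flatteningRank_pow_le_two_pow {t : ι → κ → μ → K} {m n : ℕ}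
    (h : TensorRestrictsTo (kroneckerPow (unitTensor K 2) m) (kroneckerPow t n)) :
    flatteningRank t ^ n ≤ 2 ^ m :=
  calc flatteningRank t ^ n = flatteningRank (kroneckerPow t n) :=
        (flatteningRank_kroneckerPow t n).symm
    _ ≤ flatteningRank (kroneckerPow (unitTensor K 2) m) := flatteningRank_mono h
    _ ≤ tensorRank (kroneckerPow (unitTensor K 2) m) := flatteningRank_le_tensorRank _
    _ ≤ tensorRank (unitTensor K 2) ^ m := tensorRank_kroneckerPow_le _ _
    _ ≤ 2 ^ m := Nat.pow_le_pow_left (tensorRank_unitTensor_le 2) m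

/-- **`log₂ ζ⁽¹⁾(t) ≤ ω(⟨2⟩, t)`** (CVZ §4.1: "the best known lower bounds on `R̃(t)` are simply the
matrix ranks of each of the three flattenings", in the form needed for `i(t)`; no hypothesis on `t`).
[cite: ChristandlVranaZuiddam2021, Prop. 17] -/
theorem logb_flatteningRank_le_relativeExponent (t : ι → κ → μ → K) :
    Real.logb 2 (flatteningRank t) ≤ relativeExponent (unitTensor K 2) t := by
  rcases Nat.eq_zero_or_pos (flatteningRank t) with h0 | hpos
  · rw [h0, Nat.cast_zero, Real.logb_zero]
    exact relativeExponent_nonneg _ _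
  refine le_relativeExponent_of_forall (fun n => exists_unitTensor_pow_restrictsTo_pow t (n + 1))
    fun m n h => ?_
  have key := flatteningRank_pow_le_two_pow h
  have hF : (0 : ℝ) < flatteningRank t := by exact_mod_cast hpos
  have hle : ((flatteningRank t : ℝ)) ^ (n + 1) ≤ (2 : ℝ) ^ m := by exact_mod_cast key
  have hlog := Real.logb_le_logb_of_le (b := 2) one_lt_two (by positivity) hle
  rw [Real.logb_pow, Real.logb_pow, Real.logb_self_eq_one one_lt_two, mul_one] at hlog
  push_cast at hlog
  linarith

end Flattening

/-! ## The weighted block bound for the slice rank of powers -/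

section Weights

variable {K : Type u} [Field K]
variable {ι κ μ : Type*} [Fintype ι] [Fintype κ] [Fintype μ]

/-- **Markov step**: for weights `w ≥ 0` of total mass `≤ 1`, at most `θ^{-m}` words of length `m`
have weight `∏ₗ w(xₗ) ≥ θ^m` (the total weight of all words is `(∑ w)^m ≤ 1`). [folklore] -/
theorem card_heavyWords_le {X : Type*} [Fintype X] (w : X → ℝ) (hw0 : ∀ a, 0 ≤ w a)
    (hw1 : ∑ a, w a ≤ 1) (m : ℕ) {θ : ℝ} (hθ : 0 < θ) :
    (((Finset.univ.filter fun x : Fin m → X => θ ^ m ≤ ∏ l, w (x l)).card : ℕ) : ℝ) ≤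
      (1 / θ) ^ m := by
  have hθm : (0 : ℝ) < θ ^ m := pow_pos hθ m
  have htotal : ∑ x : Fin m → X, ∏ l, w (x l) = (∑ a, w a) ^ m := by
    rw [← Fintype.prod_sum fun (_ : Fin m) (a : X) => w a]
    simp
  have hsum_le :
      ((Finset.univ.filter fun x : Fin m → X => θ ^ m ≤ ∏ l, w (x l)).card : ℝ) * θ ^ m ≤ 1 :=
    calc ((Finset.univ.filter fun x : Fin m → X => θ ^ m ≤ ∏ l, w (x l)).card : ℝ) * θ ^ m
          = ∑ _x ∈ Finset.univ.filter fun x : Fin m → X => θ ^ m ≤ ∏ l, w (x l), θ ^ m := by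
            rw [Finset.sum_const, nsmul_eq_mul]
      _ ≤ ∑ x ∈ Finset.univ.filter fun x : Fin m → X => θ ^ m ≤ ∏ l, w (x l), ∏ l, w (x l) :=
            Finset.sum_le_sum fun x hx => (Finset.mem_filter.1 hx).2
      _ ≤ ∑ x : Fin m → X, ∏ l, w (x l) :=
            Finset.sum_le_sum_of_subset_of_nonneg (Finset.subset_univ _) fun x _ _ =>
              Finset.prod_nonneg fun l _ => hw0 (x l)
      _ = (∑ a, w a) ^ m := htotal
      _ ≤ 1 := pow_le_one₀ (Finset.sum_nonneg fun a _ => hw0 a) hw1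
  rw [one_div, inv_pow, ← one_div, le_div_iff₀ hθm]
  exact hsum_le

/-- **The weighted block bound**: if `w₁(a) w₂(b) w₃(c) ≥ θ³ > 0` on the support of `t`, for weights
`wᵢ ≥ 0` of total mass `≤ 1`, then `S(t^{⊗m}) ≤ 3 θ^{-m}` for every `m` (block criterion: on the
support of `t^{⊗m}` one of the three words has weight `≥ θ^m`). This is the one-distribution
("cross-entropy") form of the upper support functional bound with `θ = (1/3,1/3,1/3)`.
[cite: ChristandlVranaZuiddam2021, §4.2] -/
theorem sliceRank_kroneckerPow_le_of_weights [DecidableEq ι] [DecidableEq κ] [DecidableEq μ]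
    (t : ι → κ → μ → K) (w₁ : ι → ℝ) (w₂ : κ → ℝ) (w₃ : μ → ℝ) (h₁0 : ∀ a, 0 ≤ w₁ a)
    (h₂0 : ∀ b, 0 ≤ w₂ b) (h₃0 : ∀ c, 0 ≤ w₃ c) (h₁1 : ∑ a, w₁ a ≤ 1) (h₂1 : ∑ b, w₂ b ≤ 1)
    (h₃1 : ∑ c, w₃ c ≤ 1) {θ : ℝ} (hθ : 0 < θ)
    (hsupp : ∀ a b c, t a b c ≠ 0 → θ ^ 3 ≤ w₁ a * w₂ b * w₃ c) (m : ℕ) :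
    (sliceRank (kroneckerPow t m) : ℝ) ≤ 3 * (1 / θ) ^ m := by
  classical
  set S₁ := Finset.univ.filter fun x : Fin m → ι => θ ^ m ≤ ∏ l, w₁ (x l) with hS₁
  set S₂ := Finset.univ.filter fun y : Fin m → κ => θ ^ m ≤ ∏ l, w₂ (y l) with hS₂
  set S₃ := Finset.univ.filter fun z : Fin m → μ => θ ^ m ≤ ∏ l, w₃ (z l) with hS₃
  have hblock : ∀ x y z, x ∉ S₁ → y ∉ S₂ → z ∉ S₃ → kroneckerPow t m x y z = 0 := by
    intro x y z hx hy hz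
    simp only [hS₁, hS₂, hS₃, Finset.mem_filter, Finset.mem_univ, true_and, not_le] at hx hy hz
    by_contra hne
    rw [kroneckerPow_apply] at hne
    have hall : ∀ l, t (x l) (y l) (z l) ≠ 0 := fun l h0 =>
      hne (Finset.prod_eq_zero (Finset.mem_univ l) h0)
    -- the product of the three word weights is at least `θ^{3m}` ...
    have hge : (θ ^ 3) ^ m ≤ (∏ l, w₁ (x l)) * (∏ l, w₂ (y l)) * ∏ l, w₃ (z l) := by
      rw [← Finset.prod_mul_distrib, ← Finset.prod_mul_distrib]
      calc (θ ^ 3) ^ m = ∏ _l : Fin m, θ ^ 3 := by simp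
        _ ≤ ∏ l, w₁ (x l) * w₂ (y l) * w₃ (z l) :=
            Finset.prod_le_prod (fun l _ => pow_nonneg hθ.le 3) fun l _ => hsupp _ _ _ (hall l)
    -- ... but each factor is `< θ^m`
    have hP₁ : 0 ≤ ∏ l, w₁ (x l) := Finset.prod_nonneg fun l _ => h₁0 _
    have hP₂ : 0 ≤ ∏ l, w₂ (y l) := Finset.prod_nonneg fun l _ => h₂0 _
    have hlt : (∏ l, w₁ (x l)) * (∏ l, w₂ (y l)) * (∏ l, w₃ (z l)) < θ ^ m * θ ^ m * θ ^ m :=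
      mul_lt_mul'' (mul_lt_mul'' hx hy hP₁ hP₂) hz (mul_nonneg hP₁ hP₂)
        (Finset.prod_nonneg fun l _ => h₃0 _)
    have : (θ ^ 3) ^ m = θ ^ m * θ ^ m * θ ^ m := by ring
    linarith
  have h := sliceRank_le_of_block (kroneckerPow t m) S₁ S₂ S₃ hblock
  have c₁ := card_heavyWords_le w₁ h₁0 h₁1 m hθ
  have c₂ := card_heavyWords_le w₂ h₂0 h₂1 m hθ
  have c₃ := card_heavyWords_le w₃ h₃0 h₃1 m hθ
  have hcast : (sliceRank (kroneckerPow t m) : ℝ) ≤ (S₁.card : ℝ) + S₂.card + S₃.card := by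
    exact_mod_cast h
  linarith

/-- **From the block bound to exponents**: under the hypotheses of
`sliceRank_kroneckerPow_le_of_weights`, a witness `t^{⊗m} ≥ ⟨2⟩^{⊗n}` has `n ≤ m · log₂(1/θ)`.
(For every `j`, `t^{⊗jm} ≥ ⟨2⟩^{⊗jn} ≅ ⟨2^{jn}⟩`, so `2^{jn} ≤ S(t^{⊗jm}) ≤ 3 θ^{-jm}` by Tao's lemma;
let `j → ∞`.) [cite: ChristandlVranaZuiddam2021, §4.2] -/
theorem le_mul_logb_of_weights [DecidableEq ι] [DecidableEq κ] [DecidableEq μ]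
    (t : ι → κ → μ → K) (w₁ : ι → ℝ) (w₂ : κ → ℝ) (w₃ : μ → ℝ) (h₁0 : ∀ a, 0 ≤ w₁ a)
    (h₂0 : ∀ b, 0 ≤ w₂ b) (h₃0 : ∀ c, 0 ≤ w₃ c) (h₁1 : ∑ a, w₁ a ≤ 1) (h₂1 : ∑ b, w₂ b ≤ 1)
    (h₃1 : ∑ c, w₃ c ≤ 1) {θ : ℝ} (hθ : 0 < θ)
    (hsupp : ∀ a b c, t a b c ≠ 0 → θ ^ 3 ≤ w₁ a * w₂ b * w₃ c) {m n : ℕ}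
    (h : TensorRestrictsTo (kroneckerPow t m) (kroneckerPow (unitTensor K 2) n)) :
    (n : ℝ) ≤ m * Real.logb 2 (1 / θ) := by
  -- for every `j`: `2^{jn} ≤ 3 θ^{-jm}`
  have hj : ∀ j : ℕ, ((2 : ℝ) ^ n) ^ j ≤ 3 * ((1 / θ) ^ m) ^ j := by
    intro j
    have hw : TensorRestrictsTo (kroneckerPow t (j * m)) (unitTensor K (2 ^ (j * n))) := by
      have h1 : TensorRestrictsTo (kroneckerPow t (j * m))
          (kroneckerPow (kroneckerPow (unitTensor K 2) n) j) :=
        (tensorMonRestrictsTo_kroneckerPow_mul t j m).tensorRestrictsTo.trans (h.kroneckerPow j)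
      have h2 : TensorRestrictsTo (kroneckerPow (kroneckerPow (unitTensor K 2) n) j)
          (kroneckerPow (unitTensor K 2) (j * n)) :=
        (tensorMonRestrictsTo_kroneckerPow_mul' (unitTensor K 2) j n).tensorRestrictsTo
      exact (h1.trans h2).trans (tensorMonRestrictsTo_pow_unitTensor 2 (j * n)).tensorRestrictsTo
    have hS : ((2 ^ (j * n) : ℕ) : ℝ) ≤ sliceRank (kroneckerPow t (j * m)) := by
      exact_mod_cast le_sliceRank_of_restrictsTo_unitTensor hw
    have hB := sliceRank_kroneckerPow_le_of_weights t w₁ w₂ w₃ h₁0 h₂0 h₃0 h₁1 h₂1 h₃1 hθ hsupp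
      (j * m)
    calc ((2 : ℝ) ^ n) ^ j = ((2 ^ (j * n) : ℕ) : ℝ) := by push_cast; rw [← pow_mul, mul_comm]
      _ ≤ 3 * ((1 / θ) ^ m) ^ j := by rw [← pow_mul, mul_comm m j]; exact hS.trans hB
  have hθm : (0 : ℝ) < (1 / θ) ^ m := pow_pos (by positivity) m
  -- hence `2^n ≤ θ^{-m}`
  have hle : (2 : ℝ) ^ n ≤ (1 / θ) ^ m := by
    by_contra hlt
    rw [not_le] at hlt
    have hy : 1 < (2 : ℝ) ^ n / (1 / θ) ^ m := (one_lt_div hθm).2 hlt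
    obtain ⟨j, hj3⟩ := pow_unbounded_of_one_lt (3 : ℝ) hy
    have := hj j
    rw [div_pow, lt_div_iff₀ (pow_pos hθm j)] at hj3
    linarith
  have hlog := Real.logb_le_logb_of_le (b := 2) one_lt_two (by positivity) hle
  rwa [Real.logb_pow, Real.logb_pow, Real.logb_self_eq_one one_lt_two, mul_one] at hlog

/-- **`1 / log₂(1/θ) ≤ ω(t, ⟨2⟩)`** under the hypotheses of `sliceRank_kroneckerPow_le_of_weights`
with `θ < 1`, as soon as some power of `t` restricts to `⟨2⟩` (so that every set defining `ω(t,⟨2⟩)`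
is nonempty); this is `ω(t,⟨2⟩) = 1/log₂ Q̃(t) ≥ 1/ρ^θ(t)` of CVZ §4.2 for the uniform `θ` and the
cross-entropy certificate `w`. [cite: ChristandlVranaZuiddam2021, §4.2] -/
theorem inv_logb_le_relativeExponent_of_weights [DecidableEq ι] [DecidableEq κ] [DecidableEq μ]
    (t : ι → κ → μ → K) (w₁ : ι → ℝ) (w₂ : κ → ℝ) (w₃ : μ → ℝ) (h₁0 : ∀ a, 0 ≤ w₁ a)
    (h₂0 : ∀ b, 0 ≤ w₂ b) (h₃0 : ∀ c, 0 ≤ w₃ c) (h₁1 : ∑ a, w₁ a ≤ 1) (h₂1 : ∑ b, w₂ b ≤ 1)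
    (h₃1 : ∑ c, w₃ c ≤ 1) {θ : ℝ} (hθ : 0 < θ) (hθ1 : θ < 1)
    (hsupp : ∀ a b c, t a b c ≠ 0 → θ ^ 3 ≤ w₁ a * w₂ b * w₃ c) {m₀ : ℕ}
    (hw : TensorRestrictsTo (kroneckerPow t m₀) (unitTensor K 2)) :
    1 / Real.logb 2 (1 / θ) ≤ relativeExponent t (unitTensor K 2) := by
  have hγ : 0 < Real.logb 2 (1 / θ) := Real.logb_pos one_lt_two (one_lt_one_div hθ hθ1)
  refine le_relativeExponent_of_forall (exists_tensorRestrictsTo_pow_of_witness hw) fun m n h => ?_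
  have key := le_mul_logb_of_weights t w₁ w₂ w₃ h₁0 h₂0 h₃0 h₁1 h₂1 h₃1 hθ hsupp h
  rw [one_div, inv_mul_le_iff₀ hγ]
  push_cast at key
  linarith

end Weights

end Literature.Barriers.MatrixMultiplication

end
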